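import Mathlib
import Literature.AlgebraicGeometry.Resolution.CompletedChainTransfer
import Literature.AlgebraicGeometry.Resolution.ChartTwoPolygonLaws
import Literature.AlgebraicGeometry.Resolution.CurveBlowupPolygonLaws
import Literature.AlgebraicGeometry.Resolution.CurveStepPrepared
import HarnessLib

/-!
# The polygon laws of the completed chain (`τ = 1` endgame, OPTION R glue)

Topic: `Literature/AlgebraicGeometry/Resolution`. V. Cossart, U. Jannsen, S. Saito, LNM 2270 (2020):
Lemma 12.1 (3) (`u₁`-chart origin: `α′ = δ − 1`, `β′ = γ⁻ ≤ β`), Lemma 12.2 (3) (`u₂`-chart origin: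
`α″ = α`, `β″ ≤ α + β − 1`), Lemma 12.4 (4) (blowing up `V(y, u₁)`: `α′ = α − 1`, `β′ = β`; by the
`u₁ ↔ u₂` symmetry also `V(y, u₂)`: `α′ = α`, `ζ′ ≤ ζ − 1`) [cite: CossartJannsenSaito2020, Lemma 12.1];
V. Cossart, O. Piltant, J. Algebra 320 (2008), Lemma 4.5 [cite: CossartPiltant2008, Lemma 4.5].

OURS (glue for the completed-chain descent R-5): the tree's ring-generic chart laws
(`PointBlowupPolygonLaws`, `ChartTwoPolygonLaws`, `CurveBlowupPolygonLaws`, `PolygonSymmetry`)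
instantiated on the I/O of the completed-chain step bricks — the `𝔪`-adic completions
`φ̂ : R̂ → R̂′` of a step `φ : R → R′`, the weak transform read through
`CompletedChainTransfer.weakTransform_adicCompletion_of_eq`, and labels `x, x′` tied by the bricks'
chart relations. No facts, no definitions:

* `completedChain_pointStep_laws` — (1 : a) rational point step (`completedChain_point_step`'s I/O):
  `α′ + L = δ`, `β′ = γ⁻`, `β′ ≤ β`;
* `completedChain_pointStepTwo_laws` — opposite vertex `(0 : 1)` in print orientation (`c′ 2 = φ̂ c₂`,
  `φ̂ c₀ = φ̂ c₂ · c′₀`, `φ̂ c₁ = φ̂ c₂ · c′₁`): `α″ = α`, `β″ + L ≤ α + β`;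
* `completedChain_curveStep_laws` — (0,1) curve step (`completedChain_curve_step`'s I/O): `α′ + L = α`,
  `β′ = β`;
* `completedChain_curveStepTwo_laws` — (0,2) curve step in print orientation (`c′ 1 = φ̂ c₁`,
  `φ̂ c₀ = φ̂ c₂ · c′₀`, `c′ 2 = φ̂ c₂`, `J ⊆ (c₀, c₂)^μ`): `α′ = α`, `β′ + L ≤ β`.

Only `J ⊆ 𝔪^μ`, non-empty polygon and `L < δ` (resp. permissibility) of the INPUT are needed — no
preparedness. F-71 / T1 / N2 NOT proved; no summit statement is proved. AI-written; weaker than expert review.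
-/

noncomputable section

open IsLocalRing MvPolynomial

namespace Literature.AlgebraicGeometry.Resolution

universe u

/-! ## Print-orientation laws for abstract charts (the `u₂`-centred curve step by symmetry) -/

section CurveTwo

variable {R R' : Type u} [CommRing R] [CommRing R'] (φ : R →+* R') {c : Fin 3 → R}
  {c' : Fin 3 → R'} (h₁ : c' 1 = φ (c 1)) (h₀ : φ (c 0) = φ (c 2) * c' 0)
  (h₂ : c' 2 = φ (c 2))
  [IsRegularLocalRing R] [IsRegularLocalRing R']
  (hgen : Ideal.span {c 0, c 1, c 2} = maximalIdeal R) (hdim : ringKrullDim R = 3)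
  (hgen' : Ideal.span {c' 0, c' 1, c' 2} = maximalIdeal R') (hdim' : ringKrullDim R' = 3)
  {J : Ideal R} {μ : ℕ}

include h₁ h₀ h₂ hgen hdim hgen' hdim' in
/-- **Blowing up the curve `V(y, u₂)`** (CJS Lemma 12.4 (4) with `u₁ ↔ u₂`): with `y = u₂ y′`,
`u₁′ = u₁`, `u₂′ = u₂` and `J ⊆ (y, u₂)^μ`, the weak transform `J′ = (J R′ : (φ u₂)^μ)` has `α′ = α`
and `β′ + L ≤ β` (the polygon is translated by `(0, −1)`; scaled, and `≤` as the tree's `ζ` law).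
[cite: CossartJannsenSaito2020, Lemma 12.4 (4)] [cite: CossartPiltant2008, Lemma 4.5 (1)] -/
theorem alphaS_betaS_colon_curveTwo (hJP : J ≤ Ideal.span {c 0, c 2} ^ μ)
    (hne : (pts c J μ).Nonempty) (hδ : μ.factorial < deltaS c J μ) :
    alphaS c' ((Ideal.map φ J).colon {φ (c 2) ^ μ}) μ = alphaS c J μ ∧
      betaS c' ((Ideal.map φ J).colon {φ (c 2) ^ μ}) μ + μ.factorial ≤ betaS c J μ := by
  -- the swapped systems are in the `(y, u₁)`-curve chart
  have k₁ : (c' ∘ σ₁₂) 1 = φ ((c ∘ σ₁₂) 1) := by simpa using h₂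
  have k₀ : φ ((c ∘ σ₁₂) 0) = φ ((c ∘ σ₁₂) 1) * (c' ∘ σ₁₂) 0 := by simpa using h₀
  have k₂ : (c' ∘ σ₁₂) 2 = φ ((c ∘ σ₁₂) 2) := by simpa using h₁
  have hne' : (pts (c ∘ σ₁₂) J μ).Nonempty := (pts_comp_σ₁₂_nonempty_iff c J μ).mpr hne
  have hδ' : μ.factorial < deltaS (c ∘ σ₁₂) J μ := by rwa [deltaS_comp_σ₁₂]
  have hJP' : J ≤ Ideal.span {(c ∘ σ₁₂) 0, (c ∘ σ₁₂) 1} ^ μ := by simpa using hJP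
  have hα' : μ.factorial ≤ alphaS (c ∘ σ₁₂) J μ :=
    factorial_le_alphaS_of_le_span_pair_pow (c ∘ σ₁₂) (chartTwo_hgen hgen) hdim hJP' hne'
  have hε := epsS_colon_curve_eq φ k₁ k₀ k₂ (chartTwo_hgen hgen) hdim (chartTwo_hgen' hgen') hdim'
    hJP' hne' hδ' hα'
  have hζ := zetaS_colon_curve_add_le φ k₁ k₀ k₂ (chartTwo_hgen hgen) hdim (chartTwo_hgen' hgen') hdim'
    hJP' hne' hδ' hα'
  have hcol : (Ideal.map φ J).colon {φ ((c ∘ σ₁₂) 1) ^ μ} = (Ideal.map φ J).colon {φ (c 2) ^ μ} := by simp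
  rw [hcol] at hε hζ
  refine ⟨?_, ?_⟩
  · calc alphaS c' ((Ideal.map φ J).colon {φ (c 2) ^ μ}) μ
        = alphaS ((c' ∘ σ₁₂) ∘ σ₁₂) ((Ideal.map φ J).colon {φ (c 2) ^ μ}) μ := by rw [comp_σ₁₂_comp_σ₁₂]
      _ = epsS (c' ∘ σ₁₂) ((Ideal.map φ J).colon {φ (c 2) ^ μ}) μ := alphaS_comp_σ₁₂ _ _ _
      _ = epsS (c ∘ σ₁₂) J μ := hε
      _ = alphaS c J μ := epsS_comp_σ₁₂ c J μ
  · have hb : betaS c' ((Ideal.map φ J).colon {φ (c 2) ^ μ}) μ =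
        zetaS (c' ∘ σ₁₂) ((Ideal.map φ J).colon {φ (c 2) ^ μ}) μ := by
      calc betaS c' ((Ideal.map φ J).colon {φ (c 2) ^ μ}) μ
          = betaS ((c' ∘ σ₁₂) ∘ σ₁₂) ((Ideal.map φ J).colon {φ (c 2) ^ μ}) μ := by rw [comp_σ₁₂_comp_σ₁₂]
        _ = zetaS (c' ∘ σ₁₂) ((Ideal.map φ J).colon {φ (c 2) ^ μ}) μ := betaS_comp_σ₁₂ _ _ _
    rw [hb, ← zetaS_comp_σ₁₂ c J μ]
    exact hζ

end CurveTwo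


/-! ## The laws on the I/O of the completed-chain step bricks -/

section Completed

variable {R R' : Type u} [CommRing R] [CommRing R'] [IsRegularLocalRing R] [IsRegularLocalRing R']
  (φ : R →+* R') (hφm : (maximalIdeal R).map φ ≤ maximalIdeal R')
  (hdim : ringKrullDim R = 3) (hdim' : ringKrullDim R' = 3)
  [IsRegularLocalRing (AdicCompletion (maximalIdeal R) R)] [IsRegularLocalRing (AdicCompletion (maximalIdeal R') R')]

include hdim hdim' in
/-- **(L1) the rational `(1 : a)` point step** (`completedChain_point_step`'s input/output): in the
completed chain `α(x′) + L = δ(x)`, `β(x′) = γ⁻(x)` and `β(x′) ≤ β(x)` (CJS Lemma 12.1 (3)).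
[cite: CossartJannsenSaito2020, Lemma 12.1 (3)] [cite: CossartPiltant2008, Lemma 4.5 (2)] -/
theorem completedChain_pointStep_laws {I : Ideal R} {I' : Ideal R'} {μ : ℕ} (u : R)
    (hIμ : I ≤ maximalIdeal R ^ μ) (hI : I' = (I.map φ).colon {φ u ^ μ})
    (x : Fin 3 → (AdicCompletion (maximalIdeal R) R)) (hx1 : x 1 = (algebraMap R (AdicCompletion (maximalIdeal R) R)) u)
    (hgenx : Ideal.span {x 0, x 1, x 2} = maximalIdeal (AdicCompletion (maximalIdeal R) R))
    (hne : (pts x (I.map (algebraMap R (AdicCompletion (maximalIdeal R) R))) μ).Nonempty) (hδ : μ.factorial < deltaS x (I.map (algebraMap R (AdicCompletion (maximalIdeal R) R))) μ)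
    (x' : Fin 3 → (AdicCompletion (maximalIdeal R') R')) (hx'1 : x' 1 = (algebraMap R' (AdicCompletion (maximalIdeal R') R')) (φ u))
    (hgenx' : Ideal.span {x' 0, x' 1, x' 2} = maximalIdeal (AdicCompletion (maximalIdeal R') R'))
    (h₀ : (adicCompletionMap (maximalIdeal R) (maximalIdeal R') φ hφm) (x 0) = (adicCompletionMap (maximalIdeal R) (maximalIdeal R') φ hφm) (x 1) * x' 0) (h₂ : (adicCompletionMap (maximalIdeal R) (maximalIdeal R') φ hφm) (x 2) = (adicCompletionMap (maximalIdeal R) (maximalIdeal R') φ hφm) (x 1) * x' 2) :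
    alphaS x' (I'.map (algebraMap R' (AdicCompletion (maximalIdeal R') R'))) μ + μ.factorial = deltaS x (I.map (algebraMap R (AdicCompletion (maximalIdeal R) R))) μ ∧
      betaS x' (I'.map (algebraMap R' (AdicCompletion (maximalIdeal R') R'))) μ = gammaMinusS x (I.map (algebraMap R (AdicCompletion (maximalIdeal R) R))) μ ∧ betaS x' (I'.map (algebraMap R' (AdicCompletion (maximalIdeal R') R'))) μ ≤ betaS x (I.map (algebraMap R (AdicCompletion (maximalIdeal R) R))) μ := by
  have hdimA : ringKrullDim (AdicCompletion (maximalIdeal R) R) = 3 := by rw [ringKrullDim_adicCompletion, hdim]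
  have hdimB : ringKrullDim (AdicCompletion (maximalIdeal R') R') = 3 := by rw [ringKrullDim_adicCompletion, hdim']
  have hIμA : (I.map (algebraMap R (AdicCompletion (maximalIdeal R) R))) ≤ maximalIdeal (AdicCompletion (maximalIdeal R) R) ^ μ := map_le_pow_maximalIdeal_adicCompletion hIμ
  have h₁ : x' 1 = (adicCompletionMap (maximalIdeal R) (maximalIdeal R') φ hφm) (x 1) := by rw [hx'1, hx1, adicCompletionMap_algebraMap]
  have hJ' : (I'.map (algebraMap R' (AdicCompletion (maximalIdeal R') R'))) = ((I.map (algebraMap R (AdicCompletion (maximalIdeal R) R))).map (adicCompletionMap (maximalIdeal R) (maximalIdeal R') φ hφm)).colon {(adicCompletionMap (maximalIdeal R) (maximalIdeal R') φ hφm) (x 1) ^ μ} := by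
    rw [hx1]; exact weakTransform_adicCompletion_of_eq φ hφm hI
  rw [hJ']
  exact ⟨alphaS_colon_add (adicCompletionMap (maximalIdeal R) (maximalIdeal R') φ hφm) h₁ h₀ h₂ hgenx hdimA hgenx' hdimB hIμA hne hδ,
    betaS_colon_eq (adicCompletionMap (maximalIdeal R) (maximalIdeal R') φ hφm) h₁ h₀ h₂ hgenx hdimA hgenx' hdimB hIμA hne hδ,
    betaS_colon_le (adicCompletionMap (maximalIdeal R) (maximalIdeal R') φ hφm) h₁ h₀ h₂ hgenx hdimA hgenx' hdimB hIμA hne hδ⟩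

include hdim hdim' in
/-- **(L2) the opposite-vertex `(0 : 1)` point step**, print orientation: for completed labels with
`c′ 2 = φ̂ c₂`, `φ̂ c₀ = φ̂ c₂ · c′₀`, `φ̂ c₁ = φ̂ c₂ · c′₁`, the weak transform `(J R̂′ : (φ̂ c₂)^μ)` has
`α″ = α` and `β″ + L ≤ α + β` (CJS Lemma 12.2 (3); strict `β`-drop when `α < L`).
[cite: CossartJannsenSaito2020, Lemma 12.2 (3)] [cite: CossartPiltant2008, Lemma 4.5 (2)] -/
theorem completedChain_pointStepTwo_laws {J : Ideal (AdicCompletion (maximalIdeal R) R)} {μ : ℕ}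
    (hJμ : J ≤ maximalIdeal (AdicCompletion (maximalIdeal R) R) ^ μ) (c : Fin 3 → (AdicCompletion (maximalIdeal R) R)) (hgen : Ideal.span {c 0, c 1, c 2} = maximalIdeal (AdicCompletion (maximalIdeal R) R))
    (hne : (pts c J μ).Nonempty) (hδ : μ.factorial < deltaS c J μ)
    (c' : Fin 3 → (AdicCompletion (maximalIdeal R') R')) (hgen' : Ideal.span {c' 0, c' 1, c' 2} = maximalIdeal (AdicCompletion (maximalIdeal R') R'))
    (h₂ : c' 2 = (adicCompletionMap (maximalIdeal R) (maximalIdeal R') φ hφm) (c 2)) (h₀ : (adicCompletionMap (maximalIdeal R) (maximalIdeal R') φ hφm) (c 0) = (adicCompletionMap (maximalIdeal R) (maximalIdeal R') φ hφm) (c 2) * c' 0) (h₁ : (adicCompletionMap (maximalIdeal R) (maximalIdeal R') φ hφm) (c 1) = (adicCompletionMap (maximalIdeal R) (maximalIdeal R') φ hφm) (c 2) * c' 1) :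
    alphaS c' ((J.map (adicCompletionMap (maximalIdeal R) (maximalIdeal R') φ hφm)).colon {(adicCompletionMap (maximalIdeal R) (maximalIdeal R') φ hφm) (c 2) ^ μ}) μ = alphaS c J μ ∧
      betaS c' ((J.map (adicCompletionMap (maximalIdeal R) (maximalIdeal R') φ hφm)).colon {(adicCompletionMap (maximalIdeal R) (maximalIdeal R') φ hφm) (c 2) ^ μ}) μ + μ.factorial ≤ alphaS c J μ + betaS c J μ := by
  have hdimA : ringKrullDim (AdicCompletion (maximalIdeal R) R) = 3 := by rw [ringKrullDim_adicCompletion, hdim]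
  have hdimB : ringKrullDim (AdicCompletion (maximalIdeal R') R') = 3 := by rw [ringKrullDim_adicCompletion, hdim']
  exact ⟨alphaS_colon_two_eq (adicCompletionMap (maximalIdeal R) (maximalIdeal R') φ hφm) h₂ h₀ h₁ hgen hdimA hgen' hdimB hJμ hne hδ,
    betaS_colon_two_add_le (adicCompletionMap (maximalIdeal R) (maximalIdeal R') φ hφm) h₂ h₀ h₁ hgen hdimA hgen' hdimB hJμ hne hδ⟩

include hdim hdim' in
/-- **(L3) the `(0,1)` curve step** (`completedChain_curve_step`'s input/output; permissibility
`I R̂ ⊆ (x₀, x₁)^μ` is part of that output): `α(x′) + L = α(x)` and `β(x′) = β(x)` (CJS Lemma 12.4 (4)).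
[cite: CossartJannsenSaito2020, Lemma 12.4 (4)] [cite: CossartPiltant2008, Lemma 4.5 (1)] -/
theorem completedChain_curveStep_laws {I : Ideal R} {I' : Ideal R'} {μ : ℕ} (u : R)
    (hI : I' = (I.map φ).colon {φ u ^ μ})
    (x : Fin 3 → (AdicCompletion (maximalIdeal R) R)) (hx1 : x 1 = (algebraMap R (AdicCompletion (maximalIdeal R) R)) u)
    (hgenx : Ideal.span {x 0, x 1, x 2} = maximalIdeal (AdicCompletion (maximalIdeal R) R))
    (hne : (pts x (I.map (algebraMap R (AdicCompletion (maximalIdeal R) R))) μ).Nonempty) (hδ : μ.factorial < deltaS x (I.map (algebraMap R (AdicCompletion (maximalIdeal R) R))) μ)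
    (hperm : (I.map (algebraMap R (AdicCompletion (maximalIdeal R) R))) ≤ Ideal.span {x 0, x 1} ^ μ)
    (x' : Fin 3 → (AdicCompletion (maximalIdeal R') R')) (hx'1 : x' 1 = (algebraMap R' (AdicCompletion (maximalIdeal R') R')) (φ u))
    (hgenx' : Ideal.span {x' 0, x' 1, x' 2} = maximalIdeal (AdicCompletion (maximalIdeal R') R'))
    (h₀ : (adicCompletionMap (maximalIdeal R) (maximalIdeal R') φ hφm) (x 0) = (adicCompletionMap (maximalIdeal R) (maximalIdeal R') φ hφm) (x 1) * x' 0) (hx'2 : x' 2 = (adicCompletionMap (maximalIdeal R) (maximalIdeal R') φ hφm) (x 2)) :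
    alphaS x' (I'.map (algebraMap R' (AdicCompletion (maximalIdeal R') R'))) μ + μ.factorial = alphaS x (I.map (algebraMap R (AdicCompletion (maximalIdeal R) R))) μ ∧ betaS x' (I'.map (algebraMap R' (AdicCompletion (maximalIdeal R') R'))) μ = betaS x (I.map (algebraMap R (AdicCompletion (maximalIdeal R) R))) μ := by
  have hdimA : ringKrullDim (AdicCompletion (maximalIdeal R) R) = 3 := by rw [ringKrullDim_adicCompletion, hdim]
  have hdimB : ringKrullDim (AdicCompletion (maximalIdeal R') R') = 3 := by rw [ringKrullDim_adicCompletion, hdim']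
  have h₁ : x' 1 = (adicCompletionMap (maximalIdeal R) (maximalIdeal R') φ hφm) (x 1) := by rw [hx'1, hx1, adicCompletionMap_algebraMap]
  have hJ' : (I'.map (algebraMap R' (AdicCompletion (maximalIdeal R') R'))) = ((I.map (algebraMap R (AdicCompletion (maximalIdeal R) R))).map (adicCompletionMap (maximalIdeal R) (maximalIdeal R') φ hφm)).colon {(adicCompletionMap (maximalIdeal R) (maximalIdeal R') φ hφm) (x 1) ^ μ} := by
    rw [hx1]; exact weakTransform_adicCompletion_of_eq φ hφm hI
  have hα : μ.factorial ≤ alphaS x (I.map (algebraMap R (AdicCompletion (maximalIdeal R) R))) μ := factorial_le_alphaS_of_le_span_pair_pow x hgenx hdimA hperm hne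
  rw [hJ']
  exact ⟨alphaS_colon_curve_add (adicCompletionMap (maximalIdeal R) (maximalIdeal R') φ hφm) h₁ h₀ hx'2 hgenx hdimA hgenx' hdimB hperm hne hδ hα,
    betaS_colon_curve_eq (adicCompletionMap (maximalIdeal R) (maximalIdeal R') φ hφm) h₁ h₀ hx'2 hgenx hdimA hgenx' hdimB hperm hne hδ hα⟩

include hdim hdim' in
/-- **(L4) the `(0,2)` curve step**, print orientation: for completed labels with `c′ 1 = φ̂ c₁`,
`φ̂ c₀ = φ̂ c₂ · c′₀`, `c′ 2 = φ̂ c₂` and `J ⊆ (c₀, c₂)^μ`, the weak transform `(J R̂′ : (φ̂ c₂)^μ)` has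
`α′ = α` and `β′ + L ≤ β` (CJS Lemma 12.4 (4) with `u₁ ↔ u₂`).
[cite: CossartJannsenSaito2020, Lemma 12.4 (4)] [cite: CossartPiltant2008, Lemma 4.5 (1)] -/
theorem completedChain_curveStepTwo_laws {J : Ideal (AdicCompletion (maximalIdeal R) R)} {μ : ℕ}
    (c : Fin 3 → (AdicCompletion (maximalIdeal R) R)) (hgen : Ideal.span {c 0, c 1, c 2} = maximalIdeal (AdicCompletion (maximalIdeal R) R))
    (hperm : J ≤ Ideal.span {c 0, c 2} ^ μ)
    (hne : (pts c J μ).Nonempty) (hδ : μ.factorial < deltaS c J μ)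
    (c' : Fin 3 → (AdicCompletion (maximalIdeal R') R')) (hgen' : Ideal.span {c' 0, c' 1, c' 2} = maximalIdeal (AdicCompletion (maximalIdeal R') R'))
    (h₁ : c' 1 = (adicCompletionMap (maximalIdeal R) (maximalIdeal R') φ hφm) (c 1)) (h₀ : (adicCompletionMap (maximalIdeal R) (maximalIdeal R') φ hφm) (c 0) = (adicCompletionMap (maximalIdeal R) (maximalIdeal R') φ hφm) (c 2) * c' 0) (h₂ : c' 2 = (adicCompletionMap (maximalIdeal R) (maximalIdeal R') φ hφm) (c 2)) :
    alphaS c' ((J.map (adicCompletionMap (maximalIdeal R) (maximalIdeal R') φ hφm)).colon {(adicCompletionMap (maximalIdeal R) (maximalIdeal R') φ hφm) (c 2) ^ μ}) μ = alphaS c J μ ∧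
      betaS c' ((J.map (adicCompletionMap (maximalIdeal R) (maximalIdeal R') φ hφm)).colon {(adicCompletionMap (maximalIdeal R) (maximalIdeal R') φ hφm) (c 2) ^ μ}) μ + μ.factorial ≤ betaS c J μ := by
  have hdimA : ringKrullDim (AdicCompletion (maximalIdeal R) R) = 3 := by rw [ringKrullDim_adicCompletion, hdim]
  have hdimB : ringKrullDim (AdicCompletion (maximalIdeal R') R') = 3 := by rw [ringKrullDim_adicCompletion, hdim']
  exact alphaS_betaS_colon_curveTwo (adicCompletionMap (maximalIdeal R) (maximalIdeal R') φ hφm) h₁ h₀ h₂ hgen hdimA hgen' hdimB hperm hne hδ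

end Completed

end Literature.AlgebraicGeometry.Resolution

end
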